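import Summits.AtomisticToContinuum.Crystallization.Theorems.FrustratedLawDichotomyStrainedPatchHomEntryLeafHTA2QCellB910S2
import Summits.AtomisticToContinuum.Crystallization.Theorems.FrustratedLawDichotomyStrainedPatchHomEntryLeafHTA2QSq

/-!
# ★★★ THE `0.9 t_b` CELL END TO END WITH TWO INNER LEAVES: `entryLeafOKHT4A2QQDCRS muRec qX90c pB910A2 QB910 GnB910 JT090 tB910 cT090 wB910 = true`
# (27623 `(H) HomFloor (1/625)`, hcp half; hand-1 g36; critic row 1360 (4) «⑤‴ per-band spec»)

decomp-a2c hand-1 g36 (crux `AperiodicFrustratedLawGap`, stmt-AtomisticToContinuum-27623).  KERNEL: ★ `treeA2QS_B910` — the TWO-leaf inner tree `tB910` (`ζ_y × 2`;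
leaves `≈ (1.675 + 1.244, 1.068 + 1.445, 0.784 + 0.062)e-3` after the hull) of the squared-test inner verdict `…SqKit.entryLeafOKHQDCRS muRec qX90c` closes the
sheet-tracked confined box `htWr pB910A2 = (1.675, 2.135, 0.784)e-3` of the `0.9 t_b` `2⁻¹⁰` cell (seat probe R13: one leaf false, `t2y`/`t4`/`t8` true; the inner
verdict of record false even at 8 leaves — hand-1 g36 probe Q6: at `0.9 t_b` its ξ reach is `(2.0, 2.3, 0.5)e-3`, the squared test's `(2.65, 3.1, 0.62)e-3`); with
`…CellB910S2.htCertSideA2Q_B910A2`: ★★★ `entryLeafOKHT4A2QQDCRS_B910A2` and ★ `okSE_B910`.  PER-CELL COST at `0.9 t_b`: certificate ≈ 500 s + two inner leaves.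

Kernel definition (the two-leaf tree) + kernel fact + assembly; 0 sorry; standard axioms; no instances / notation / `#eval`.  `--supports stmt-AtomisticToContinuum-27623`.
-/

namespace Summit.AtomisticToContinuum.Crystallization.Theorems.FrustratedLawDichotomyStrainedPatchHomEntryLeafHT

open Literature.Analysis.ValidatedNumerics.Numerics
open Summit.AtomisticToContinuum.Crystallization.Theorems.FrustratedLawDichotomyStrainedPatchHomCertTree (CertTree treeOK)
open Summit.AtomisticToContinuum.Crystallization.Theorems.FrustratedLawDichotomyStrainedPatchHomEntryTable (muRec)
open Summit.AtomisticToContinuum.Crystallization.Theorems.FrustratedLawDichotomyStrainedPatchHomEntryFitTolerance (cT090)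
open Summit.AtomisticToContinuum.Crystallization.Theorems.FrustratedLawDichotomyStrainedPatchHomEntryFitHcpCentred (entryLeafOKHQDCRS)
open Summit.AtomisticToContinuum.Crystallization.Theorems.FrustratedLawDichotomyStrainedPatchHomSlopeLJ
open Summit.AtomisticToContinuum.Crystallization.Theorems.FrustratedLawDichotomyStrainedPatchHomSlopeLJAffine
open Summit.AtomisticToContinuum.Crystallization.Theorems.FrustratedLawDichotomyStrainedPatchHomSlopeLJAffine2Kit

/-- The two-leaf inner tree (`ζ_y × 2`). -/
def tB910 : CertTree ((Fin 3 × Fin 3) ⊕ Fin 3) := .split (Sum.inr 1) .leaf .leaf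

set_option maxRecDepth 100000 in
set_option maxHeartbeats 4000000 in
/-- ★ KERNEL: the TWO-leaf inner tree of the squared-test inner verdict closes the second-order confined box of the `0.9 t_b` cell. -/
theorem treeA2QS_B910 : treeOK (hullInner (entryLeafOKHQDCRS muRec qX90c) JT090 cT090) tB910 cT090 (htWr pB910A2 cT090 wB910) = true := by
  decide +kernel

/-- ★★★ **THE `0.9 t_b` CELL CLOSES END TO END THROUGH THE SECOND-ORDER AFFINE LEAF WITH THE SQUARED INNER TEST** (two inner leaves). [assembly] -/
theorem entryLeafOKHT4A2QQDCRS_B910A2 : entryLeafOKHT4A2QQDCRS muRec qX90c pB910A2 QB910 GnB910 JT090 tB910 cT090 wB910 = true := by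
  have h1 := htCertSideA2Q_B910A2
  have h2 := treeA2QS_B910
  unfold entryLeafOKHT4A2QQDCRS entryLeafOKHT4A2Q
  rw [h1, h2]
  rfl

/-- ★ … hence the `0.9 t_b` cell is a one-leaf ∃-tree of the production verdict v2 `entryLeafOKHT4A2QQDCRSE muRec`. [formal bookkeeping] -/
theorem okSE_B910 : ∃ t : CertTree ((Fin 3 × Fin 3) ⊕ Fin 3), treeOK (entryLeafOKHT4A2QQDCRSE muRec) t cT090 wB910 = true :=
  exists_tree_HT4A2QQDCRSE_of_certS entryLeafOKHT4A2QQDCRS_B910A2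
end Summit.AtomisticToContinuum.Crystallization.Theorems.FrustratedLawDichotomyStrainedPatchHomEntryLeafHT
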